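import Summits.BirchSwinnertonDyer.BirchSwinnertonDyer.Theses.KatoDescentPotSupersingular
import HarnessLib

/-!
# Route `KatoDescentPotSupersingular` (rung K9, cell `bsd-potss`): the identity glue item
# stmt-BirchSwinnertonDyer-19566 `PublishedInputIsogenyInvarianceBSDOfNamed` — bookkeeping (the third
# child is definitionally the parent); no mathematics; BSD is not proved by any of this (seat k8t-c4 g3)
-/

set_option autoImplicit false
-- the Theorems directory repeats the summit name (sibling precedent `KatoDescentPotSupersingularAssembly.lean`)
set_option linter.dupNamespace false

namespace Summit.BirchSwinnertonDyer.BirchSwinnertonDyer.Theorems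

/-- **Glue item 19566** (`PublishedInputRankEqAnalyticRank → PublishedInputEntireLFunction →
PublishedInputIsogenyInvarianceBSDByName → PublishedInputIsogenyInvarianceBSD`): the last child is the
parent by definition (both are the named fact `WeierstrassCurve.bsdRHS_eq_of_isIsogenous`, Cassels 1965 /
Milne ADT I.7.3, stated BY NAME — nothing about it is asserted); the first two children ride along for
staffability bookkeeping only. Term `fun _ _ h ↦ h` (the planner's certified sketch). [cite: MilneADT2006, Thm. I.7.3 (p. 97)] -/
theorem publishedInputIsogenyInvarianceBSDOfNamed_proof :
    Summit.BirchSwinnertonDyer.BirchSwinnertonDyer.Theses.KatoDescentPotSupersingular.PublishedInputIsogenyInvarianceBSDOfNamed :=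
  fun _ _ h ↦ h

end Summit.BirchSwinnertonDyer.BirchSwinnertonDyer.Theorems
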